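import Summits.KontsevichZagierPeriods.KontsevichZagierPeriods.Theorems.TerasomaMultiplicationTriplicationFromMultiplicationSimplex
import Summits.KontsevichZagierPeriods.KontsevichZagierPeriods.Theorems.TerasomaMultiplicationTriplicationFromMultiplicationBridges

/-!
# `TriplicationFromMultiplication` (stmt-KontsevichZagierPeriods-13693): the cancellation glue

`MultiplicationThree → ReflectionThird → BetaCancellation → TriplicationAccessible`
(route KontsevichZagierPeriods/TerasomaMultiplication, support item #9): the Gauss-triplication pair
`[(0,1)², x^{-8/9}(1-x)^{-5/9}y^{-4/9}(1-y)^{-2/9}] ∼ [{x²+y²<4}, 3^{7/6}/2]`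
(`B(1/9,4/9)B(5/9,7/9) = 2·3^{7/6}π`) follows from the `n = 3` pure-Beta multiplication pair at
`s = 1/9`, Euler reflection at `1/3` and cancellation of Beta classes, by an explicit ring derivation
INSIDE the Kontsevich–Zagier calculus.

The derivation (this file's, Newton–Leibniz-free; `β(a,b) = [(0,1), t^{a-1}(1-t)^{b-1}]`,
`A = β(1/3,1/9)β(2/3,1/9)`, `ρ = β(1/3,2/3)`, `RA` = Dirichlet re-association
`β(a,b)β(a+b,c) ∼ β(b,c)β(b+c,a) ∼ β(a,c)β(a+c,b) ∼ β(c,a)β(c+a,b)`, each two rule-2 moves through the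
simplex representation):
1. `r ∼ β(1/9,4/9)β(5/9,7/9) ∼ β(1/9,7/9)β(8/9,4/9)`;
2. `β(2/3,1/9)β(7/9,1/9) ∼ β(1/9,1/9)β(2/9,2/3)`; 3. `β(2/9,2/3)β(8/9,4/9) ∼ β(4/9,2/9)β(2/3,2/3)`;
4. `β(1/3,1/9)β(4/9,2/9) ∼ β(1/9,2/9)β(1/3,1/3)`; 5. `β(1/3,1/3)β(2/3,2/3) ∼ β(1/3,2/3)β(1,1/3)`;
6. `β(1,1/3) ∼ β(1/3,1) ∼ [(0,1),3]` (Kummer dilation `t ↦ t³`) and `[(0,1),3] × ρ ∼ 3ρ`;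
hence `A × r ∼ β(1/9,2/9)β(1/9,1/9) × 3ρ`; `MultiplicationThree` (`A ∼ 3^{-2/3}β(1/9,2/9)β(1/9,1/9)`)
and `ReflectionThird` (`sin(π/3)ρ ∼ [π]`) turn this into `A × r ∼ A × 2·3^{7/6}[π]`, `BetaCancellation`
(twice) cancels `A`, and `2·3^{7/6}[π] ∼ [unit disc, 2·3^{7/6}] ∼ r'` (null circle; scaling `z ↦ 2z`).
-/

noncomputable section

open MeasureTheory Set
open scoped BigOperators

namespace Summit.KontsevichZagierPeriods.TerasomaMultiplication.TriplicationGlue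

open Literature.NumberTheory.Transcendental
open Literature.NumberTheory.Transcendental.KZ
open MvPolynomial (aeval X C)
open Summit.KontsevichZagierPeriods.KontsevichZagierPeriods.BetaCancellationNegative (betaKernel polyKernelRep)
open Summit.KontsevichZagierPeriods.KontsevichZagierPeriods.Theses.TerasomaMultiplication
  (MultiplicationThree ReflectionThird BetaCancellation TriplicationAccessible TriplicationFromMultiplication)

/-- The Beta family `(X₀, 1 − X₀)` on `ℝ¹` (local notation `bF`). -/
local notation "bF" => (![MvPolynomial.X 0, 1 - MvPolynomial.X 0] : Fin 2 → MvPolynomial (Fin 1) ℚ)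

/-- The Beta representation `β(a,b)` (local notation; `h` is the convergence proof). -/
local notation "𝛃(" a ", " b ", " h ")" =>
  IntegralRep.ofMellin (![MvPolynomial.X 0, 1 - MvPolynomial.X 0] : Fin 2 → MvPolynomial (Fin 1) ℚ)
    ![a - 1, b - 1] 1 h

/-! ## The constant: `3 / (sin(π/3) · 9·27^{-8/9}) = 2·3^{7/6}` -/

/-- `2·3^{7/6} · (3^{1/2}/2) · (9 · 3^{-8/3}) = 3`. [folklore] -/
theorem three_rpow_bookkeeping :
    2 * (3:ℝ) ^ ((7:ℝ) / 6) * ((3:ℝ) ^ ((1:ℝ) / 2) / 2) * (9 * (3:ℝ) ^ (-(8:ℝ) / 3)) = 3 := by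
  have h3 : (0:ℝ) < 3 := by norm_num
  rw [show (9:ℝ) = (3:ℝ) ^ (2:ℝ) by rw [Real.rpow_two]; norm_num,
    show 2 * (3:ℝ) ^ ((7:ℝ) / 6) * ((3:ℝ) ^ ((1:ℝ) / 2) / 2) * ((3:ℝ) ^ (2:ℝ) * (3:ℝ) ^ (-(8:ℝ) / 3)) =
      (3:ℝ) ^ ((7:ℝ) / 6) * (3:ℝ) ^ ((1:ℝ) / 2) * ((3:ℝ) ^ (2:ℝ) * (3:ℝ) ^ (-(8:ℝ) / 3)) by ring,
    ← Real.rpow_add h3, ← Real.rpow_add h3, ← Real.rpow_add h3]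
  norm_num

/-- **The constant of the derivation**: `3 · sin(π/3)⁻¹ · (9·27^{1/9−1})⁻¹ = 2·3^{7/6}`. [folklore] -/
theorem kappa_identity :
    3 * (Real.sin (Real.pi / 3))⁻¹ * (MultiplicationThreeNegative.pullConst (1 / 9))⁻¹ =
      2 * (3:ℝ) ^ ((7:ℝ) / 6) := by
  have h3 : (0:ℝ) < 3 := by norm_num
  have hsin : Real.sin (Real.pi / 3) = (3:ℝ) ^ ((1:ℝ) / 2) / 2 := by
    rw [Real.sin_pi_div_three, Real.sqrt_eq_rpow]
  have h27 : (27:ℝ) ^ (((1 / 9 : ℚ) : ℝ) - 1) = (3:ℝ) ^ (-(8:ℝ) / 3) := by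
    rw [show (27:ℝ) = (3:ℝ) ^ ((3:ℕ):ℝ) by rw [Real.rpow_natCast]; norm_num, ← Real.rpow_mul h3.le]
    push_cast
    norm_num
  unfold MultiplicationThreeNegative.pullConst
  rw [hsin, h27]
  have hA : (3:ℝ) ^ ((1:ℝ) / 2) / 2 ≠ 0 := by positivity
  have hB : 9 * (3:ℝ) ^ (-(8:ℝ) / 3) ≠ 0 := by positivity
  have key := three_rpow_bookkeeping
  field_simp at key ⊢
  linarith [key]

/-- `2·3^{7/6}` is algebraic. [folklore] -/
theorem isAlgebraic_kappa : IsAlgebraic ℚ (2 * (3:ℝ) ^ ((7:ℝ) / 6)) := by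
  have h := KoblitzOgus.isAlgebraic_nat_rpow_rat (m := 3) (by norm_num) 7 (q := 6) (by norm_num)
  have e : (3:ℝ) ^ ((7:ℝ) / 6) = ((3:ℕ):ℝ) ^ (((7:ℤ):ℝ) / ((6:ℕ):ℝ)) := by push_cast; norm_num
  rw [e]
  exact (isAlgebraic_nat 2).mul h

/-! ## The theorem -/

/-- **`TriplicationFromMultiplication`** (stmt-KontsevichZagierPeriods-13693): the cancellation glue
`MultiplicationThree → ReflectionThird → BetaCancellation → TriplicationAccessible` of route
TerasomaMultiplication, by the Newton–Leibniz-free ring derivation described in the module docstring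
(Dirichlet re-associations, reflections, one Kummer dilation, the unit slab, `MultiplicationThree` at
`s = 1/9`, `ReflectionThird`, two Beta cancellations, the null unit circle and the scaling `z ↦ 2z`).
[folklore] -/
theorem triplicationFromMultiplication_proof : TriplicationFromMultiplication := by
  intro hM hR hB r r' hr hri hr' hri'
  -- convergence of the sixteen Beta integrals of the derivation
  have c13_19 := integrableOn_beta (a := 1 / 3) (b := 1 / 9) (by norm_num) (by norm_num)
  have c23_19 := integrableOn_beta (a := 2 / 3) (b := 1 / 9) (by norm_num) (by norm_num)
  have c19_49 := integrableOn_beta (a := 1 / 9) (b := 4 / 9) (by norm_num) (by norm_num)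
  have c59_79 := integrableOn_beta (a := 5 / 9) (b := 7 / 9) (by norm_num) (by norm_num)
  have c19_79 := integrableOn_beta (a := 1 / 9) (b := 7 / 9) (by norm_num) (by norm_num)
  have c89_49 := integrableOn_beta (a := 8 / 9) (b := 4 / 9) (by norm_num) (by norm_num)
  have c79_19 := integrableOn_beta (a := 7 / 9) (b := 1 / 9) (by norm_num) (by norm_num)
  have c19_19 := integrableOn_beta (a := 1 / 9) (b := 1 / 9) (by norm_num) (by norm_num)
  have c29_23 := integrableOn_beta (a := 2 / 9) (b := 2 / 3) (by norm_num) (by norm_num)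
  have c49_29 := integrableOn_beta (a := 4 / 9) (b := 2 / 9) (by norm_num) (by norm_num)
  have c23_23 := integrableOn_beta (a := 2 / 3) (b := 2 / 3) (by norm_num) (by norm_num)
  have c19_29 := integrableOn_beta (a := 1 / 9) (b := 2 / 9) (by norm_num) (by norm_num)
  have c13_13 := integrableOn_beta (a := 1 / 3) (b := 1 / 3) (by norm_num) (by norm_num)
  have c13_23 := integrableOn_beta (a := 1 / 3) (b := 2 / 3) (by norm_num) (by norm_num)
  have c1_13 := integrableOn_beta (a := 1) (b := 1 / 3) (by norm_num) (by norm_num)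
  have c13_1 := integrableOn_beta (a := 1 / 3) (b := 1) (by norm_num) (by norm_num)
  have h3 : IsAlgebraic ℚ (3:ℝ) := isAlgebraic_nat 3
  -- the representations
  set a := 𝛃(1 / 3, 1 / 9, c13_19) with ha
  set b := 𝛃(2 / 3, 1 / 9, c23_19) with hb
  set ρ := 𝛃(1 / 3, 2 / 3, c13_23) with hρ
  set X := (𝛃(1 / 9, 2 / 9, c19_29)).prod (𝛃(1 / 9, 1 / 9, c19_19)) with hX
  set L4 := (𝛃(1 / 9, 7 / 9, c19_79)).prod (𝛃(8 / 9, 4 / 9, c89_49)) with hL4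
  -- Step 0–1: r ∼ β(1/9,4/9) × β(5/9,7/9) ∼ β(1/9,7/9) × β(8/9,4/9) = L4
  have e0 : Equivalent r ((𝛃(1 / 9, 4 / 9, c19_49)).prod (𝛃(5 / 9, 7 / 9, c59_79))) := by
    refine of_sub_of_mem_relations_of_eqOn ?_ fun x hx => ?_
    · rw [prod_beta_domain, hr]
      ext x
      simp only [mem_setOf_eq, Fin.forall_fin_two]
    · rw [prod_beta_integrand, hri hx]
      simp only [betaKernel]
      have e1 : (((1 / 9 : ℚ) : ℝ) - 1) = -(8:ℝ) / 9 := by push_cast; norm_num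
      have e2 : (((4 / 9 : ℚ) : ℝ) - 1) = -(5:ℝ) / 9 := by push_cast; norm_num
      have e3 : (((5 / 9 : ℚ) : ℝ) - 1) = -(4:ℝ) / 9 := by push_cast; norm_num
      have e4 : (((7 / 9 : ℚ) : ℝ) - 1) = -(2:ℝ) / 9 := by push_cast; norm_num
      rw [e1, e2, e3, e4]
      ring
  have e1 : Equivalent r L4 :=
    e0.trans (reassoc' (a := 1 / 9) (b := 4 / 9) (c := 7 / 9) (d := 5 / 9) (e := 8 / 9)
      (by norm_num) (by norm_num) (by norm_num) (by norm_num) (by norm_num) c19_49 c59_79 c19_79 c89_49)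
  -- Steps 2–6: A × L4 ∼ X × 3ρ
  have s2 : Equivalent (b.prod ((𝛃(7 / 9, 1 / 9, c79_19)).prod (𝛃(8 / 9, 4 / 9, c89_49))))
      ((𝛃(1 / 9, 1 / 9, c19_19)).prod ((𝛃(2 / 9, 2 / 3, c29_23)).prod (𝛃(8 / 9, 4 / 9, c89_49)))) :=
    combine12 _ (reassoc (a := 2 / 3) (b := 1 / 9) (c := 1 / 9) (d := 7 / 9) (e := 2 / 9)
      (by norm_num) (by norm_num) (by norm_num) (by norm_num) (by norm_num) c23_19 c79_19 c19_19 c29_23)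
  have s3 : Equivalent ((𝛃(2 / 9, 2 / 3, c29_23)).prod (𝛃(8 / 9, 4 / 9, c89_49)))
      ((𝛃(4 / 9, 2 / 9, c49_29)).prod (𝛃(2 / 3, 2 / 3, c23_23))) :=
    reassoc2 (a := 2 / 9) (b := 2 / 3) (c := 4 / 9) (d := 8 / 9) (e := 2 / 3)
      (by norm_num) (by norm_num) (by norm_num) (by norm_num) (by norm_num) c29_23 c89_49 c49_29 c23_23
  have s5 : Equivalent (a.prod ((𝛃(4 / 9, 2 / 9, c49_29)).prod ((𝛃(1 / 9, 1 / 9, c19_19)).prod (𝛃(2 / 3, 2 / 3, c23_23)))))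
      ((𝛃(1 / 9, 2 / 9, c19_29)).prod ((𝛃(1 / 3, 1 / 3, c13_13)).prod ((𝛃(1 / 9, 1 / 9, c19_19)).prod (𝛃(2 / 3, 2 / 3, c23_23))))) :=
    combine12 _ (reassoc (a := 1 / 3) (b := 1 / 9) (c := 2 / 9) (d := 4 / 9) (e := 1 / 3)
      (by norm_num) (by norm_num) (by norm_num) (by norm_num) (by norm_num) c13_19 c49_29 c19_29 c13_13)
  have s7 : Equivalent ((𝛃(1 / 3, 1 / 3, c13_13)).prod (𝛃(2 / 3, 2 / 3, c23_23))) (ρ.prod (𝛃(1, 1 / 3, c1_13))) :=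
    reassoc' (a := 1 / 3) (b := 1 / 3) (c := 2 / 3) (d := 2 / 3) (e := 1)
      (by norm_num) (by norm_num) (by norm_num) (by norm_num) (by norm_num) c13_13 c23_23 c13_23 c1_13
  have s8 : Equivalent (ρ.prod (𝛃(1, 1 / 3, c1_13))) (ρ.constMul 3 h3) :=
    (((prod_congr_right ρ (beta_symm c1_13 c13_1)).trans
      (prod_congr_right ρ (unit_three_equiv_beta_third_one h3 c13_1).symm)).trans
      (prod_comm ρ _)).trans (const_unit_prod ρ h3)
  have t : Equivalent ((𝛃(1 / 3, 1 / 3, c13_13)).prod (𝛃(2 / 3, 2 / 3, c23_23))) (ρ.constMul 3 h3) :=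
    s7.trans s8
  have chain : Equivalent ((a.prod b).prod L4) (X.prod (ρ.constMul 3 h3)) := by
    refine (prod_assoc a b L4).symm.trans ?_
    refine (prod_congr_right a (prod_congr_right b (prod_congr_left (beta_symm c19_79 c79_19) _))).trans ?_
    refine (prod_congr_right a s2).trans ?_
    refine (prod_congr_right a (prod_congr_right _ s3)).trans ?_
    refine (prod_congr_right a (swap12 _ _ _)).trans ?_
    refine s5.trans ?_
    refine (prod_congr_right _ (swap12 _ _ _)).trans ?_
    refine (prod_congr_right _ (prod_congr_right _ t)).trans ?_
    exact prod_assoc _ _ _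
  -- `MultiplicationThree` at `s = 1/9`: `A ∼ c₁ · X`, hence `X ∼ c₁⁻¹ · A`
  have hc₁ := isAlgebraic_pullConst_ninth
  have hA : Equivalent (a.prod b) (X.constMul _ hc₁) :=
    multiplicationThree_ninth hM c13_19 c23_19 c19_29 c19_19 hc₁
  have hX : Equivalent X ((a.prod b).constMul _ hc₁.inv) :=
    equivalent_constMul_inv_of hc₁ pullConst_ninth_ne_zero hA.symm
  -- `ReflectionThird`: `sin(π/3) · ρ ∼ [π]`, hence `3ρ ∼ (3 sin(π/3)⁻¹) · [π]`
  have hs := isAlgebraic_sin_pi_div_three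
  have hρπ : Equivalent (ρ.constMul _ hs) piRep := reflectionThird_beta hR hs c13_23
  have hρ3 : Equivalent (ρ.constMul 3 h3) ((piRep.constMul _ hs.inv).constMul 3 h3) :=
    (equivalent_constMul_inv_of hs sin_pi_div_three_ne_zero hρπ).constMul 3 h3
  -- assemble: `A × r ∼ A × P`, `P = 2·3^{7/6} · [π]`
  set P := piRep.constMul _ isAlgebraic_kappa with hP
  have hAP : Equivalent ((a.prod b).prod r) ((a.prod b).prod P) := by
    refine ((prod_congr_right _ e1).trans chain).trans ?_
    refine (Equivalent.prod hX hρ3).trans ?_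
    rw [constMul_prod_eq, prod_constMul_eq, prod_constMul_eq, constMul_constMul_eq, constMul_constMul_eq,
      hP, prod_constMul_eq]
    rw [constMul_congr _ _ isAlgebraic_kappa (by rw [← kappa_identity]; ring)]
  -- cancel the two Beta factors of `A`
  have hbr : Equivalent (b.prod r) (b.prod P) :=
    beta_cancel hB (by norm_num) (by norm_num) c13_19 ((prod_assoc a b r).trans (hAP.trans (prod_assoc a b P).symm))
  have hrP : Equivalent r P := beta_cancel hB (by norm_num) (by norm_num) c23_19 hbr
  -- the target pair
  exact hrP.trans (piRep_const_equiv_target isAlgebraic_kappa r' hr' hri')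

end Summit.KontsevichZagierPeriods.TerasomaMultiplication.TriplicationGlue
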